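import Mathlib.Data.ZMod.Basic
import Literature.GroupTheory.CombinatorialGroupTheory.SchreierTreeFreeBasis
import HarnessLib

/-!
# The Schreier basis of the cyclic kernel `Ker(F ↠ ℤ/m)` of a free group: translates of the other letters and `t^m`

Topic `Literature/GroupTheory/CombinatorialGroupTheory`; theorems only (no definitions).  R. C. Lyndon,
P. E. Schupp, *Combinatorial Group Theory*, Ch. I Prop. 3.7–3.9 (Schreier's method) [cite: LyndonSchupp2001, Ch. I Prop. 3.7],
in the simplest non-trivial instance — the one every cyclic covering of a graph / of a punctured surface
unwrapping ONE letter `t` is read in: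

> Let `F` be free on `X`, `t ∈ X`, `m ≥ 1`, and `χ : F → ℤ/m` the exponent sum of `t` mod `m` (the other
> letters go to `0`).  Then `K = Ker χ` (index `m`, normal) is free on the `m(|X| − 1) + 1` elements
> `t^j x t^{-j}` (`x ∈ X ∖ {t}`, `0 ≤ j < m`) and `t^m`.

This is Schreier's basis for the transversal `{t^{-j}}` read backwards — we let `t` act on `ℤ/m` by
`b ↦ b − 1`, take the transversal `a ↦ (t^{a})⁻¹` and the tree of `t`-edges not ending at `0`, and apply the
tree's `CoveringPresentation.exists_mulEquiv_nonTreeEdges` (abc-iut-w5-d186 / abc-iut-L5-d3, the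
Reidemeister–Schreier layer).  Results:

* `FreeGroup.exists_mulEquiv_cyclicKernel` — the statement in `FreeGroup X`;
* `FreeGroupBasis.exists_freeGroupBasis_cyclicKernel` — the same along any free basis `b : X → Γ` of an
  abstract group `Γ`; `FreeGroupBasis.index_cyclicKernel` (`[Γ : K] = m`);
* `FreeGroupBasis.closure_hnnVertex_eq_map_closure_image` — for `m ≥ 2` and a letter `x₀ ≠ t` the subgroup
  `⟨X ∖ {t}, t x₀ t⁻¹⟩` (the vertex group of the HNN-splitting of `Γ` along `⟨x₀⟩ ~ ⟨t x₀ t⁻¹⟩`: e.g. the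
  fundamental group of an irreducible one-nodal curve's component inside that of its smoothing) is generated
  by a SUB-BASIS of this basis of `K` — although it is not a free factor of `Γ` itself (same rank as `Γ`,
  infinite index).  Consumer: [CombGC] Prop. 1.2 (ii) at the irreducible one-nodal shape
  (`Literature/AnabelianGeometry/SemiGraphs/`).

Classical; no new mathematics; no statement here takes a side on anything.
-/

namespace Literature.GroupTheory.CombinatorialGroupTheory

open CoveringPresentation Multiplicative

universe u

noncomputable section

namespace FreeGroupCyclicKernel

variable {X : Type u} [DecidableEq X] (t₀ : X) (m : ℕ) [NeZero m]

/-! ### The action of `F(X)` on `ℤ/m`: `t ↦ (b ↦ b − 1)`, the other letters act trivially -/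

omit [DecidableEq X] [NeZero m] in
/-- The translation representation `z ↦ (b ↦ b − z)` of `ℤ/m` on itself, multiplicatively written.
[cite: LyndonSchupp2001, Ch. I Prop. 3.7] -/
theorem exists_translationHom :
    ∃ ψ : Multiplicative (ZMod m) →* Equiv.Perm (ZMod m), ∀ z b, ψ z b = b - toAdd z := by
  refine ⟨{ toFun := fun z => Equiv.subRight (toAdd z), map_one' := ?_, map_mul' := ?_ },
    fun z b => ?_⟩
  · ext b; simp
  · intro z w; ext b
    simp only [toAdd_mul, Equiv.Perm.coe_mul, Function.comp_apply, Equiv.subRight_apply]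
    abel
  · simp

omit [NeZero m] in
/-- Along the action `act` (`t ↦ (b ↦ b − 1)`, `x ≠ t ↦ id`), every `f` acts as `b ↦ b − χ₀(f)` with `χ₀`
the exponent sum of `t` mod `m`. [cite: LyndonSchupp2001, Ch. I Prop. 3.7] -/
theorem act_apply (act : FreeGroup X →* Equiv.Perm (ZMod m))
    (hact : ∀ x, act (FreeGroup.of x) = if x = t₀ then Equiv.subRight (1 : ZMod m) else 1)
    (χ₀ : FreeGroup X →* Multiplicative (ZMod m))
    (hχ₀ : ∀ x, χ₀ (FreeGroup.of x) = if x = t₀ then ofAdd (1 : ZMod m) else 1)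
    (f : FreeGroup X) (b : ZMod m) : act f b = b - toAdd (χ₀ f) := by
  obtain ⟨ψ, hψ⟩ := exists_translationHom m
  have h : act = ψ.comp χ₀ := by
    refine FreeGroup.ext_hom _ _ fun x => ?_
    rw [MonoidHom.comp_apply, hact, hχ₀]
    ext b'
    by_cases hx : x = t₀
    · rw [if_pos hx, if_pos hx, hψ, Equiv.subRight_apply, toAdd_ofAdd]
    · rw [if_neg hx, if_neg hx, map_one]
  rw [h, MonoidHom.comp_apply, hψ]

omit [NeZero m] in
/-- The letter `t` acts by `b ↦ b − 1`; its `k`-th power by `b ↦ b − k`.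
[cite: LyndonSchupp2001, Ch. I Prop. 3.7] -/
theorem act_of_pow_apply (act : FreeGroup X →* Equiv.Perm (ZMod m))
    (hact : ∀ x, act (FreeGroup.of x) = if x = t₀ then Equiv.subRight (1 : ZMod m) else 1)
    (k : ℕ) (b : ZMod m) : act (FreeGroup.of t₀ ^ k) b = b - k := by
  induction k generalizing b with
  | zero => simp
  | succ k ih =>
    rw [pow_succ, map_mul, Equiv.Perm.mul_apply, hact, if_pos rfl, Equiv.subRight_apply, ih]
    push_cast
    abel

omit [NeZero m] in
/-- The inverse of the `k`-th power of `t` acts by `b ↦ b + k`. [cite: LyndonSchupp2001, Ch. I Prop. 3.7] -/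
theorem act_of_pow_inv_apply (act : FreeGroup X →* Equiv.Perm (ZMod m))
    (hact : ∀ x, act (FreeGroup.of x) = if x = t₀ then Equiv.subRight (1 : ZMod m) else 1)
    (k : ℕ) (b : ZMod m) : act (FreeGroup.of t₀ ^ k)⁻¹ b = b + k := by
  rw [map_inv, Equiv.Perm.inv_eq_iff_eq, act_of_pow_apply t₀ m act hact]
  abel

omit [NeZero m] in
/-- The inverse of the letter `t` acts by `b ↦ b + 1`. [cite: LyndonSchupp2001, Ch. I Prop. 3.7] -/
theorem act_of_inv_apply (act : FreeGroup X →* Equiv.Perm (ZMod m))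
    (hact : ∀ x, act (FreeGroup.of x) = if x = t₀ then Equiv.subRight (1 : ZMod m) else 1)
    (b : ZMod m) : act (FreeGroup.of t₀)⁻¹ b = b + 1 := by
  simpa using act_of_pow_inv_apply t₀ m act hact 1 b

omit [NeZero m] in
/-- The other letters act trivially. [cite: LyndonSchupp2001, Ch. I Prop. 3.7] -/
theorem act_of_ne_apply (act : FreeGroup X →* Equiv.Perm (ZMod m))
    (hact : ∀ x, act (FreeGroup.of x) = if x = t₀ then Equiv.subRight (1 : ZMod m) else 1)
    {x : X} (hx : x ≠ t₀) (b : ZMod m) : act (FreeGroup.of x) b = b := by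
  rw [hact, if_neg hx, Equiv.Perm.one_apply]

omit [NeZero m] in
/-- The edge word of the path of `t^k` ending at `0` runs through the `t`-edges ending at `1, …, k`; for
`k < m` none of them ends at `0`, so the word lies in the subgroup generated by the `t`-edges `(t, a)`,
`a ≠ 0`. [cite: ZieschangVogtColdewey1980, 2.2.2] -/
theorem pathWord_of_pow_mem (act : FreeGroup X →* Equiv.Perm (ZMod m))
    (hact : ∀ x, act (FreeGroup.of x) = if x = t₀ then Equiv.subRight (1 : ZMod m) else 1)
    {k : ℕ} (hk : k < m) :
    pathWord act (FreeGroup.of t₀ ^ k) 0 ∈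
      Subgroup.closure (FreeGroup.of '' {e : X × ZMod m | e.1 = t₀ ∧ e.2 ≠ 0}) := by
  induction k with
  | zero => simp
  | succ k ih =>
    rw [pow_succ, pathWord_mul, pathWord_of, act_of_pow_inv_apply t₀ m act hact, zero_add,
      act_of_inv_apply t₀ m act hact]
    refine Subgroup.mul_mem _ (ih (Nat.lt_of_succ_lt hk)) (Subgroup.subset_closure ⟨_, ⟨rfl, ?_⟩, rfl⟩)
    rw [← Nat.cast_add_one, Ne, ZMod.natCast_eq_zero_iff]
    exact Nat.not_dvd_of_pos_of_lt (Nat.succ_pos k) hk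

/-! ### The Schreier tree: transversal `a ↦ (t^{a})⁻¹`, tree = the `t`-edges not ending at `0` -/

/-- For `a ≠ 0` in `ℤ/m` (so `m ≥ 2`): `(1 : ℤ/m).val = 1` and `1 ≤ a.val`.
[cite: LyndonSchupp2001, Ch. I Prop. 3.7] -/
theorem val_one_eq_and_le {a : ZMod m} (ha : a ≠ 0) : (1 : ZMod m).val = 1 ∧ 1 ≤ a.val := by
  rcases Nat.lt_or_ge 1 m with hm | hm
  · haveI : Fact (1 < m) := ⟨hm⟩
    rw [ZMod.val_one]
    exact ⟨rfl, Nat.one_le_iff_ne_zero.mpr fun h => ha ((ZMod.val_eq_zero a).mp h)⟩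
  · have hm1 : m = 1 := le_antisymm hm (Nat.one_le_iff_ne_zero.mpr (NeZero.ne m))
    subst hm1
    exact absurd (Subsingleton.elim a 0) ha

/-- **The Schreier tree of the cyclic covering.**  For the action above with base point `0`: the
transversal `a ↦ (t^{val a})⁻¹` (so that the representative of `1` is `t⁻¹`), whose tree edges are the
`t`-edges `(t, a)` with `a ≠ 0`. [cite: ZieschangVogtColdewey1980, 2.2.2] -/
theorem exists_schreierTree (act : FreeGroup X →* Equiv.Perm (ZMod m))
    (hact : ∀ x, act (FreeGroup.of x) = if x = t₀ then Equiv.subRight (1 : ZMod m) else 1) :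
    ∃ 𝒯 : SchreierTree act (0 : ZMod m),
      (∀ a, 𝒯.t a = (FreeGroup.of t₀ ^ a.val)⁻¹) ∧ 𝒯.edges = {e : X × ZMod m | e.1 = t₀ ∧ e.2 ≠ 0} := by
  refine ⟨{ t := fun a => (FreeGroup.of t₀ ^ a.val)⁻¹
            t_root := by simp
            t_apply := fun a => ?_
            edges := {e : X × ZMod m | e.1 = t₀ ∧ e.2 ≠ 0}
            t_edge := ?_
            pathWord_t_mem := fun a => ?_ }, fun a => rfl, rfl⟩
  · rw [act_of_pow_inv_apply t₀ m act hact, zero_add, ZMod.natCast_zmod_val]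
  · rintro ⟨x, a⟩ ⟨hx, ha⟩
    change x = t₀ at hx
    change a ≠ 0 at ha
    subst hx
    show (FreeGroup.of x ^ (act (FreeGroup.of x) a).val)⁻¹ = FreeGroup.of x * (FreeGroup.of x ^ a.val)⁻¹
    obtain ⟨hv1, hk⟩ := val_one_eq_and_le m ha
    obtain ⟨k, hk'⟩ : ∃ k, a.val = k + 1 := ⟨a.val - 1, by omega⟩
    have hle : (1 : ZMod m).val ≤ a.val := by omega
    rw [hact, if_pos rfl, Equiv.subRight_apply, ZMod.val_sub hle, hv1, hk', Nat.add_sub_cancel,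
      pow_succ, mul_inv_rev, ← mul_assoc, mul_inv_cancel, one_mul]
  · show pathWord act (FreeGroup.of t₀ ^ a.val)⁻¹ a ∈ _
    rw [pathWord_inv, act_of_pow_apply t₀ m act hact, ZMod.natCast_zmod_val, sub_self]
    exact Subgroup.inv_mem _ (pathWord_of_pow_mem t₀ m act hact (ZMod.val_lt a))

/-! ### The basis -/

omit [NeZero m] in
/-- The index set `({x ≠ t} × ℤ/m) ⊔ {⋆}` of the Schreier basis is the set of non-tree edges: `(x, a)` for
`x ≠ t`, and `⋆ = (t, 0)`. [cite: LyndonSchupp2001, Ch. I Prop. 3.7] -/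
theorem exists_equiv_nonTreeEdges :
    ∃ σ : (({x : X // x ≠ t₀} × ZMod m) ⊕ Unit) ≃
        {e : X × ZMod m // e ∉ {e : X × ZMod m | e.1 = t₀ ∧ e.2 ≠ 0}},
      (∀ x a, (σ (Sum.inl (x, a)) : X × ZMod m) = (x.1, a)) ∧
        (σ (Sum.inr ()) : X × ZMod m) = (t₀, 0) := by
  classical
  refine ⟨{ toFun := fun i => match i with
              | Sum.inl (x, a) => ⟨(x.1, a), fun h => x.2 h.1⟩
              | Sum.inr () => ⟨(t₀, 0), fun h => h.2 rfl⟩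
            invFun := fun e => if h : e.1.1 = t₀ then Sum.inr () else Sum.inl (⟨e.1.1, h⟩, e.1.2)
            left_inv := ?_
            right_inv := ?_ }, fun x a => rfl, rfl⟩
  · rintro (⟨x, a⟩ | ⟨⟩)
    · simp [x.2]
    · simp
  · rintro ⟨⟨x, a⟩, he⟩
    by_cases hx : x = t₀
    · subst hx
      have ha : a = 0 := by
        by_contra ha
        exact he ⟨rfl, ha⟩
      subst ha
      simp
    · simp [hx]

end FreeGroupCyclicKernel

open FreeGroupCyclicKernel

/-- **Schreier basis of the cyclic kernel, in `F(X)`.**  Let `t ∈ X`, `m ≥ 1`, and `χ₀ : F(X) → ℤ/m` the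
exponent sum of `t` mod `m`.  Then `Ker χ₀` is free on `({x ≠ t} × ℤ/m) ⊔ {⋆}`, the basis sending `(x, a)`
to `t^{a} x t^{-a}` (`a` read in `{0, …, m−1}`) and `⋆` to `t^m`.
[cite: LyndonSchupp2001, Ch. I Prop. 3.7] -/
theorem FreeGroup.exists_mulEquiv_cyclicKernel {X : Type u} [DecidableEq X] (t₀ : X) (m : ℕ) [NeZero m]
    (χ₀ : FreeGroup X →* Multiplicative (ZMod m))
    (hχ₀ : ∀ x, χ₀ (FreeGroup.of x) = if x = t₀ then ofAdd (1 : ZMod m) else 1) :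
    ∃ Φ : FreeGroup (({x : X // x ≠ t₀} × ZMod m) ⊕ Unit) ≃* χ₀.ker,
      (∀ (x : {x : X // x ≠ t₀}) (a : ZMod m), ((Φ (FreeGroup.of (Sum.inl (x, a))) : χ₀.ker) : FreeGroup X) =
        FreeGroup.of t₀ ^ a.val * FreeGroup.of x.1 * (FreeGroup.of t₀ ^ a.val)⁻¹) ∧
      ((Φ (FreeGroup.of (Sum.inr ())) : χ₀.ker) : FreeGroup X) = FreeGroup.of t₀ ^ m := by
  classical
  -- the action
  let act : FreeGroup X →* Equiv.Perm (ZMod m) :=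
    FreeGroup.lift fun x => if x = t₀ then Equiv.subRight (1 : ZMod m) else 1
  have hact : ∀ x, act (FreeGroup.of x) = if x = t₀ then Equiv.subRight (1 : ZMod m) else 1 :=
    fun x => FreeGroup.lift_apply_of
  -- the kernel is the stabiliser of `0`
  have hK : ∀ f, f ∈ χ₀.ker ↔ act f 0 = 0 := fun f => by
    rw [MonoidHom.mem_ker, act_apply t₀ m act hact χ₀ hχ₀, sub_eq_self, toAdd_eq_zero]
  obtain ⟨𝒯, h𝒯t, h𝒯e⟩ := exists_schreierTree t₀ m act hact
  obtain ⟨Φ₀, hΦ₀, -⟩ := exists_mulEquiv_nonTreeEdges 𝒯 χ₀.ker hK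
  obtain ⟨σ, hσl, hσr⟩ := exists_equiv_nonTreeEdges t₀ m
  -- transport the index set along `σ` and the edge set along `h𝒯e`
  let τ : {e : X × ZMod m // e ∉ {e : X × ZMod m | e.1 = t₀ ∧ e.2 ≠ 0}} ≃
      {e : X × ZMod m // e ∉ 𝒯.edges} := Equiv.subtypeEquivProp (by rw [h𝒯e])
  have hτ : ∀ e, ((τ e : {e : X × ZMod m // e ∉ 𝒯.edges}) : X × ZMod m) = (e : X × ZMod m) :=
    fun e => rfl
  refine ⟨(FreeGroup.freeGroupCongr (σ.trans τ)).trans Φ₀, fun x a => ?_, ?_⟩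
  · rw [MulEquiv.trans_apply, FreeGroup.freeGroupCongr_apply, FreeGroup.map.of, hΦ₀]
    have he : ((σ.trans τ) (Sum.inl (x, a)) : X × ZMod m) = (x.1, a) := by
      rw [Equiv.trans_apply, hτ, hσl]
    rw [show ((σ.trans τ) (Sum.inl (x, a))).1.1 = x.1 from congrArg Prod.fst he,
      show ((σ.trans τ) (Sum.inl (x, a))).1.2 = a from congrArg Prod.snd he,
      act_of_ne_apply t₀ m act hact x.2, h𝒯t, inv_inv]
  · rw [MulEquiv.trans_apply, FreeGroup.freeGroupCongr_apply, FreeGroup.map.of, hΦ₀]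
    have he : ((σ.trans τ) (Sum.inr ()) : X × ZMod m) = (t₀, 0) := by
      rw [Equiv.trans_apply, hτ, hσr]
    rw [show ((σ.trans τ) (Sum.inr ())).1.1 = t₀ from congrArg Prod.fst he,
      show ((σ.trans τ) (Sum.inr ())).1.2 = 0 from congrArg Prod.snd he,
      hact, if_pos rfl, Equiv.subRight_apply, zero_sub, h𝒯t, h𝒯t, ZMod.val_zero, pow_zero, inv_one,
      mul_one, inv_inv]
    rcases Nat.lt_or_ge 1 m with hm | hm
    · haveI : Fact (1 < m) := ⟨hm⟩
      rw [ZMod.val_neg_of_ne_zero, ZMod.val_one, ← pow_succ, Nat.sub_add_cancel hm.le]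
    · have hm1 : m = 1 := le_antisymm hm (Nat.one_le_iff_ne_zero.mpr (NeZero.ne m))
      subst hm1
      rw [show (-1 : ZMod 1) = 0 from Subsingleton.elim _ _, ZMod.val_zero, pow_zero, one_mul, pow_one]

/-- **Schreier basis of the cyclic kernel along a free basis.**  Let `b : X → Γ` be a free basis of the
group `Γ`, `t ∈ X`, `m ≥ 1`, and `χ : Γ → ℤ/m` the homomorphism `b t ↦ 1`, `b x ↦ 0` (`x ≠ t`).  Then
`K = Ker χ` has a free basis indexed by `({x ≠ t} × ℤ/m) ⊔ {⋆}` with values `(b t)^{a} (b x) (b t)^{-a}` and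
`(b t)^m`. [cite: LyndonSchupp2001, Ch. I Prop. 3.7] -/
theorem FreeGroupBasis.exists_freeGroupBasis_cyclicKernel {X : Type u} {Γ : Type u} [Group Γ]
    [DecidableEq X] (b : FreeGroupBasis X Γ) (t₀ : X) (m : ℕ) [NeZero m]
    (χ : Γ →* Multiplicative (ZMod m)) (hχ : ∀ x, χ (b x) = if x = t₀ then ofAdd (1 : ZMod m) else 1) :
    ∃ bK : FreeGroupBasis (({x : X // x ≠ t₀} × ZMod m) ⊕ Unit) χ.ker,
      (∀ (x : {x : X // x ≠ t₀}) (a : ZMod m),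
        ((bK (Sum.inl (x, a)) : χ.ker) : Γ) = b t₀ ^ a.val * b x.1 * (b t₀ ^ a.val)⁻¹) ∧
      ((bK (Sum.inr ()) : χ.ker) : Γ) = b t₀ ^ m := by
  classical
  -- the character on `F(X)`
  let χ₀ : FreeGroup X →* Multiplicative (ZMod m) := χ.comp b.repr.symm.toMonoidHom
  have hχ₀ : ∀ x, χ₀ (FreeGroup.of x) = if x = t₀ then ofAdd (1 : ZMod m) else 1 := fun x => by
    change χ (b.repr.symm (FreeGroup.of x)) = _
    exact hχ x
  obtain ⟨Φ, hΦl, hΦr⟩ := FreeGroup.exists_mulEquiv_cyclicKernel t₀ m χ₀ hχ₀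
  -- `b.repr.symm` carries `Ker χ₀` onto `Ker χ`
  have hker : χ₀.ker.map b.repr.symm.toMonoidHom = χ.ker := by
    ext g
    constructor
    · rintro ⟨f, hf, rfl⟩
      exact hf
    · intro hg
      refine ⟨b.repr g, ?_, b.repr.symm_apply_apply g⟩
      change χ (b.repr.symm (b.repr g)) = 1
      rw [b.repr.symm_apply_apply]
      exact hg
  let e : χ₀.ker ≃* χ.ker := (b.repr.symm.subgroupMap χ₀.ker).trans (MulEquiv.subgroupCongr hker)
  have he : ∀ k : χ₀.ker, ((e k : χ.ker) : Γ) = b.repr.symm (k : FreeGroup X) := fun k => rfl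
  have hb : ∀ x, b.repr.symm (FreeGroup.of x) = b x := fun x => rfl
  refine ⟨FreeGroupBasis.ofRepr (Φ.trans e).symm, fun x a => ?_, ?_⟩
  · change (((Φ.trans e).symm.symm (FreeGroup.of (Sum.inl (x, a))) : χ.ker) : Γ) = _
    rw [MulEquiv.symm_symm, MulEquiv.trans_apply, he, hΦl, map_mul, map_mul, map_inv, map_pow, hb, hb]
  · change (((Φ.trans e).symm.symm (FreeGroup.of (Sum.inr ())) : χ.ker) : Γ) = _
    rw [MulEquiv.symm_symm, MulEquiv.trans_apply, he, hΦr, map_pow, hb]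

/-- The character `χ` is onto, so `[Γ : Ker χ] = m`. [cite: LyndonSchupp2001, Ch. I Prop. 3.9] -/
theorem FreeGroupBasis.index_cyclicKernel {X : Type u} {Γ : Type u} [Group Γ] [DecidableEq X]
    (b : FreeGroupBasis X Γ) (t₀ : X) (m : ℕ) [NeZero m]
    (χ : Γ →* Multiplicative (ZMod m)) (hχ : ∀ x, χ (b x) = if x = t₀ then ofAdd (1 : ZMod m) else 1) :
    χ.ker.index = m := by
  have hsurj : Function.Surjective χ := by
    intro z
    refine ⟨b t₀ ^ (toAdd z).val, ?_⟩
    rw [map_pow, hχ, if_pos rfl, ← ofAdd_nsmul, nsmul_eq_mul, mul_one, ZMod.natCast_zmod_val,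
      ofAdd_toAdd]
  rw [Subgroup.index_ker, MonoidHom.range_eq_top.mpr hsurj, Subgroup.card_top,
    Nat.card_congr Multiplicative.toAdd, Nat.card_zmod]

/-- Pushing a sub-basis closure of `K` into `Γ`: the subgroup of `Γ` generated by the members `bK i`,
`i ∈ S`. [cite: LyndonSchupp2001, Ch. I Prop. 3.7] -/
theorem FreeGroupBasis.map_subtype_closure_image {Γ : Type u} [Group Γ] {K : Subgroup Γ} {κ : Type*}
    (bK : FreeGroupBasis κ K) (S : Set κ) :
    (Subgroup.closure (bK '' S)).map K.subtype = Subgroup.closure ((fun i => (bK i : Γ)) '' S) := by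
  rw [MonoidHom.map_closure, Set.image_image]
  rfl

/-- **The HNN vertex group is a sub-basis closure of the cyclic kernel.**  For `m ≥ 2` and a letter
`x₀ ≠ t`: the subgroup `⟨b x (x ≠ t), (b t)(b x₀)(b t)⁻¹⟩` of `Γ` — not a free factor of `Γ` — is generated by
the members `(x, 0)` (`x ≠ t`) and `(x₀, 1)` of the Schreier basis of `K = Ker χ`.
[cite: LyndonSchupp2001, Ch. I Prop. 3.7] -/
theorem FreeGroupBasis.closure_hnnVertex_eq_map_closure_image {X : Type u} {Γ : Type u} [Group Γ]
    [DecidableEq X] (b : FreeGroupBasis X Γ) (t₀ : X) (m : ℕ) [NeZero m] (hm : 2 ≤ m)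
    (χ : Γ →* Multiplicative (ZMod m))
    (bK : FreeGroupBasis (({x : X // x ≠ t₀} × ZMod m) ⊕ Unit) χ.ker)
    (hbK : ∀ (x : {x : X // x ≠ t₀}) (a : ZMod m),
      ((bK (Sum.inl (x, a)) : χ.ker) : Γ) = b t₀ ^ a.val * b x.1 * (b t₀ ^ a.val)⁻¹)
    (x₀ : {x : X // x ≠ t₀}) :
    Subgroup.closure ({g : Γ | ∃ x : X, x ≠ t₀ ∧ g = b x} ∪ {b t₀ * b x₀.1 * (b t₀)⁻¹}) =
      (Subgroup.closure (bK '' ((Set.range fun x : {x : X // x ≠ t₀} => Sum.inl (x, (0 : ZMod m))) ∪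
        {Sum.inl (x₀, (1 : ZMod m))}))).map χ.ker.subtype := by
  haveI : Fact (1 < m) := ⟨hm⟩
  rw [FreeGroupBasis.map_subtype_closure_image]
  congr 1
  ext g
  simp only [Set.mem_union, Set.mem_setOf_eq, Set.mem_singleton_iff, Set.mem_image, Set.mem_range]
  constructor
  · rintro (⟨x, hx, rfl⟩ | rfl)
    · exact ⟨Sum.inl (⟨x, hx⟩, 0), Or.inl ⟨⟨x, hx⟩, rfl⟩, by
        rw [hbK, ZMod.val_zero, pow_zero, inv_one, one_mul, mul_one]⟩
    · exact ⟨Sum.inl (x₀, 1), Or.inr rfl, by rw [hbK, ZMod.val_one, pow_one]⟩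
  · rintro ⟨i, hi, rfl⟩
    rcases hi with ⟨x, rfl⟩ | rfl
    · exact Or.inl ⟨x.1, x.2, by rw [hbK, ZMod.val_zero, pow_zero, inv_one, one_mul, mul_one]⟩
    · exact Or.inr (by rw [hbK, ZMod.val_one, pow_one])

end

end Literature.GroupTheory.CombinatorialGroupTheory
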